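import Literature.AlgebraicGeometry.Motives.AbelianVarietyTranslation
import HarnessLib

/-!
# The shear: fibres of `(Q, b) ↦ f(Q)·b` over a point `a` are the preimages of `W` under `Q ↦ a·f(Q)⁻¹`

Milne, *Jacobian varieties*, §6, proof of Lemma 6.7 (p. 187): for the map `ψ : C × Θ → J`, `(Q, b) ↦ f(Q) + b`, «the fibre
`ψ⁻¹(a)` is `C ×_J Θ_a⁻`», the preimage of `Θ` under `Q ↦ a − f(Q)` — the two conditions `f(Q) + b = a` and `b = a − f(Q)` on
`T`-valued points are the same, rearranged by the group law (Mumford, *Abelian Varieties*, §4: `T`-valued points of a group scheme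
form a group functorially in `T`; Görtz–Wedhorn II, Def. 27.1: translations).

For a commutative group scheme given as an abelian variety `A` over a field `k` (tree ★ `Motives/AbelianVariety`: `A.X : SchemeOver k`
a commutative group object, Mathlib՚s `Hom.commGroup` on `T ⟶ A.X`), `k`-morphisms `f : C ⟶ A.X`, `w : W ⟶ A.X`, a rational point
`a ∈ A(k)`, the **incidence map** `ψ = (fst ≫ f)·(snd ≫ w) : C ⊗ W ⟶ A.X` and the **shear** `ι_a = a · f⁻¹ : C ⟶ A.X`, this file proves
(theorems only; no definition — `ψ` and `ι_a` enter as variables pinned by the equations `hψ`, `hι`; no named fact, no `sorry`):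

* `AbelianVariety.comp_zsmul_neg_one_id` / `…comp_neg_one_translation_eq` — the letter՚s spelling of the shear,
  `f ≫ [−1]_A ≫ t_a = (a)·f⁻¹` in the group of `C`-valued points (★ `translation`, Mathlib `GrpObj.comp_inv`);
* **`AbelianVariety.isPullback_shear`** — for ANY cartesian square `Q = C ×_{ι_a, A, w} W` of schemes and any `t : Q ⟶ (C ⊗ W)`
  with components the two projections, the square `(t, Q → Spec k; ψ, a)` is cartesian: **`Q` is the scheme-theoretic fibre of `ψ`
  over the `k`-point `a`**;
* `AbelianVariety.isPullback_shear_pullback` — the instance with Mathlib՚s chosen `pullback ι_a.left w.left` and `t = pullback.lift`.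

Use (cell `hodgecm-mathlib`, D-0151; crux HLiu418 = stmt-HodgeConjecture-24832): leaf (P3-iii) of the «fibre dictionary» of Step I on
road (E) — with `w := Z(Θ₀) ↪ J` and ★ `CartierDivisor.IsEffective.isPullback_subscheme_pullbackAvoiding` (`Z(ι_a^*Θ₀) = C ×_J Z(Θ₀)`)
the apex becomes `Z(ι_a^*Θ₀)`, which ★ `Morphisms.isReduced_of_isPullback_of_range_subset` (étale locus) then declares REDUCED, and ★
`CurvePlaces.ordAt_eq_one_of_isReduced_subscheme` reads as multiplicity one.  COUNT-NEUTRAL.  HC_CM is proved only modulo the 7 printed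
citations until rung 0 closes.

Mathlib searched (pin): `CartesianMonoidalCategory.lift/fst/snd`, `Over.tensorObj_ext`, `Over.lift_left`, `Over.fst_left`,
`Over.tensorObj_hom`, `MonObj.comp_mul`, `GrpObj.comp_inv`, `Grp.hom_hom_inv`/`hom_hom_zpow`, `Hom.inv_def`,
`IsPullback.of_isLimit'`, `PullbackCone.IsLimit.mk`, `IsPullback.lift/lift_fst/lift_snd/hom_ext` (all used).

## References
* [Milne1986JacobianVarieties] J. S. Milne, *Jacobian varieties*, in: Arithmetic Geometry (Cornell–Silverman eds.), Springer 1986,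
  §6, proof of Lemma 6.7 (p. 187).
* [MumfordAV1970] D. Mumford, *Abelian Varieties* (1970), §4 (group schemes via `T`-valued points) and §6 Cor. 4.
* [GortzWedhorn2023] U. Görtz, T. Wedhorn, *Algebraic Geometry II* (2023), Def./Rem. 27.1 (pp. 604–605).
-/

noncomputable section

open CategoryTheory CategoryTheory.Limits AlgebraicGeometry MonObj MonoidalCategory CartesianMonoidalCategory

universe u

namespace Literature.AlgebraicGeometry.Motives

namespace AbelianVariety

variable {k : Type u} [Field k] (A : AbelianVariety k)

/-! ## §0 Bookkeeping in `SchemeOver k` -/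

/-- The structure morphism of `Spec k` over itself is the identity. [folklore] -/
private theorem specOver_self_hom' : (specOver k k).hom = 𝟙 (Spec (.of k)) := by
  change Spec.map (CommRingCat.ofHom (RingHom.id k)) = _
  rw [CommRingCat.ofHom_id]
  exact Spec.map_id _

/-- A rational point is a section of the structure morphism: `a ≫ (A → Spec k) = 𝟙`. [folklore] -/
private theorem point_left_comp_hom (a : A.Points k) : a.left ≫ A.X.hom = 𝟙 (Spec (.of k)) :=
  (Over.w a).trans specOver_self_hom'

/-- Any `k`-morphism followed by the structure morphism of its target is the structure morphism of its source. [folklore] -/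
private theorem comp_toSpecOver_eq {Y X : SchemeOver k} (g : Y ⟶ X) : g ≫ toSpecOver X = toSpecOver Y := by
  apply Over.OverMorphism.ext
  change g.left ≫ X.hom = Y.hom
  exact Over.w g

/-- A `T`-valued point followed by the translation `t_a` is its product with the constant point `a_T`:
`g ≫ t_a = a_T · g`. [cite: GortzWedhorn2023, Def./Rem. 27.1 (pp. 604–605)] -/
theorem comp_translation_eq_const_mul {T : SchemeOver k} (g : T ⟶ A.X) (a : A.Points k) :
    g ≫ A.translation a = (toSpecOver T ≫ a) * g := by
  unfold translation
  rw [MonObj.comp_mul, Category.comp_id, ← Category.assoc, comp_toSpecOver_eq]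

/-- **`[−1]_A` acts as inversion on `T`-valued points**: `g ≫ [−1]_A = g⁻¹` for the endomorphism `(-1 : ℤ) • 𝟙 A` of the abelian
variety `A` (its underlying `k`-morphism is the inversion `ι` of the group object). [cite: MumfordAV1970, §4 (group schemes, T-valued points)] -/
theorem comp_zsmul_neg_one_id {T : SchemeOver k} (g : T ⟶ A.X) :
    g ≫ (InducedCategory.Hom.hom ((-1 : ℤ) • 𝟙 A)).hom.hom = g⁻¹ := by
  have h1 : InducedCategory.Hom.hom ((-1 : ℤ) • 𝟙 A) = (InducedCategory.Hom.hom (𝟙 A))⁻¹ := by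
    rw [neg_one_zsmul]
    rfl
  rw [h1, id_hom]
  change g ≫ (𝟙 A.X)⁻¹ = g⁻¹
  rw [GrpObj.comp_inv, Category.comp_id]

/-- **The shear of the letter is `a · f⁻¹`**: `f ≫ [−1]_A ≫ t_a = a_C · f⁻¹` in the group of `C`-valued points of `A`
(Milne: `Q ↦ a − f(Q)`). [cite: Milne1986JacobianVarieties, §6, proof of Lemma 6.7 (p. 187)] -/
theorem comp_neg_one_translation_eq {C : SchemeOver k} (f : C ⟶ A.X) (a : A.Points k) :
    f ≫ (InducedCategory.Hom.hom ((-1 : ℤ) • 𝟙 A)).hom.hom ≫ A.translation a = (toSpecOver C ≫ a) * f⁻¹ := by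
  rw [← Category.assoc, comp_zsmul_neg_one_id, comp_translation_eq_const_mul]

/-- The same at the level of underlying schemes (the spelling `f.left ≫ toSchemeHom ((-1:ℤ) • 𝟙 A) ≫ (t_a).left` of the road-(E) letter).
[cite: Milne1986JacobianVarieties, §6, proof of Lemma 6.7 (p. 187)] -/
theorem comp_neg_one_translation_left_eq {C : SchemeOver k} (f : C ⟶ A.X) (a : A.Points k) :
    f.left ≫ Hom.toSchemeHom ((-1 : ℤ) • 𝟙 A) ≫ (A.translation a).left = ((toSpecOver C ≫ a) * f⁻¹ : C ⟶ A.X).left := by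
  rw [← comp_neg_one_translation_eq]
  rfl

/-! ## §1 The shear identifies `C ×_{ι_a, A, w} W` with the fibre of `ψ` over `a` -/

section Shear

variable {C W : SchemeOver k} (f : C ⟶ A.X) (w : W ⟶ A.X) (a : A.Points k)
  (ψ : C ⊗ W ⟶ A.X) (hψ : ψ = (CartesianMonoidalCategory.fst C W ≫ f) * (CartesianMonoidalCategory.snd C W ≫ w))
  (sh : C ⟶ A.X) (hsh : sh = (toSpecOver C ≫ a) * f⁻¹)

include hψ hsh in
/-- The group-law rearrangement on `T`-valued points: for `F : T ⟶ C ⊗ W`, `F ≫ ψ = a_T` iff `(F ≫ snd) ≫ w = (F ≫ fst) ≫ ι_a`.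
[cite: Milne1986JacobianVarieties, §6, proof of Lemma 6.7 (p. 187)] [cite: MumfordAV1970, §4 (group schemes, T-valued points)] -/
theorem comp_incidence_eq_const_iff {T : SchemeOver k} (F : T ⟶ C ⊗ W) :
    F ≫ ψ = toSpecOver T ≫ a ↔
      (F ≫ CartesianMonoidalCategory.snd C W) ≫ w = (F ≫ CartesianMonoidalCategory.fst C W) ≫ sh := by
  subst hψ hsh
  have e1 : F ≫ ((CartesianMonoidalCategory.fst C W ≫ f) * (CartesianMonoidalCategory.snd C W ≫ w)) =
      ((F ≫ CartesianMonoidalCategory.fst C W) ≫ f) * ((F ≫ CartesianMonoidalCategory.snd C W) ≫ w) := by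
    rw [MonObj.comp_mul, Category.assoc, Category.assoc]
  have e2 : (F ≫ CartesianMonoidalCategory.fst C W) ≫ ((toSpecOver C ≫ a) * f⁻¹) =
      (toSpecOver T ≫ a) * ((F ≫ CartesianMonoidalCategory.fst C W) ≫ f)⁻¹ := by
    rw [MonObj.comp_mul, GrpObj.comp_inv, ← Category.assoc (F ≫ CartesianMonoidalCategory.fst C W) (toSpecOver C) a,
      comp_toSpecOver_eq]
  rw [e1, e2, eq_mul_inv_iff_mul_eq, mul_comm]

/-- In a cartesian square over `ι_a`, `w`, the two legs are compatible with the structure morphisms. [folklore] -/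
private theorem comp_hom_eq_of_isPullback {Q : Scheme.{u}} {q₁ : Q ⟶ C.left} {q₂ : Q ⟶ W.left}
    (hQ : IsPullback q₁ q₂ sh.left w.left) : q₁ ≫ C.hom = q₂ ≫ W.hom := by
  rw [← Over.w w, ← Category.assoc, ← hQ.w, Category.assoc, Over.w sh]

include hψ hsh in
/-- **THE SHEAR** (Milne JV, proof of Lemma 6.7: «`ψ⁻¹(a) = C ×_J Θ_a⁻`»).  Let `ψ = (fst ≫ f)·(snd ≫ w) : C ⊗ W ⟶ A` be the incidence
map and `ι_a = a·f⁻¹ : C ⟶ A` the shear.  For ANY cartesian square of schemes `Q —q₂→ W`, `Q —q₁→ C` over `ι_a`, `w`, and any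
`t : Q ⟶ C ⊗ W` with components `q₁`, `q₂`, the square `Q —t→ C ⊗ W —ψ→ A`, `Q → Spec k —a→ A` is CARTESIAN: `Q` is the fibre of `ψ`
over the `k`-point `a`. [cite: Milne1986JacobianVarieties, §6, proof of Lemma 6.7 (p. 187)] [cite: MumfordAV1970, §4 (group schemes, T-valued points)] -/
theorem isPullback_shear {Q : Scheme.{u}} {q₁ : Q ⟶ C.left} {q₂ : Q ⟶ W.left} (hQ : IsPullback q₁ q₂ sh.left w.left)
    (t : Q ⟶ (C ⊗ W).left) (ht₁ : t ≫ (CartesianMonoidalCategory.fst C W).left = q₁)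
    (ht₂ : t ≫ (CartesianMonoidalCategory.snd C W).left = q₂) :
    IsPullback t (q₁ ≫ C.hom) ψ.left a.left := by
  -- `Q` as a `k`-scheme and `t` as a `k`-morphism
  let Q' : SchemeOver k := Over.mk (q₁ ≫ C.hom)
  have htw : t ≫ (C ⊗ W).hom = q₁ ≫ C.hom := by
    rw [← ht₁, Category.assoc]
    rfl
  let T' : Q' ⟶ C ⊗ W := Over.homMk t htw
  -- the square commutes: `t ≫ ψ = a_Q`
  have hcomm : t ≫ ψ.left = (q₁ ≫ C.hom) ≫ a.left := by
    have h : T' ≫ ψ = toSpecOver Q' ≫ a := by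
      rw [comp_incidence_eq_const_iff A f w a ψ hψ sh hsh]
      apply Over.OverMorphism.ext
      change (t ≫ (CartesianMonoidalCategory.snd C W).left) ≫ w.left =
        (t ≫ (CartesianMonoidalCategory.fst C W).left) ≫ sh.left
      rw [ht₁, ht₂, hQ.w]
    exact congrArg (fun g => g.left) h
  refine IsPullback.of_isLimit' ⟨hcomm⟩ (PullbackCone.IsLimit.mk hcomm
    (fun s => hQ.lift (s.fst ≫ (CartesianMonoidalCategory.fst C W).left) (s.fst ≫ (CartesianMonoidalCategory.snd C W).left) ?_)
    (fun s => ?_) (fun s => ?_) (fun s m hm₁ hm₂ => ?_))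
  · -- the cone condition of `s`, rearranged by the group law: `(s.fst ≫ fst) ≫ ι_a = (s.fst ≫ snd) ≫ w`
    let S' : SchemeOver k := Over.mk (s.fst ≫ (C ⊗ W).hom)
    let F : S' ⟶ C ⊗ W := Over.homMk s.fst rfl
    have hS : s.fst ≫ (C ⊗ W).hom = s.snd :=
      calc s.fst ≫ (C ⊗ W).hom = s.fst ≫ ψ.left ≫ A.X.hom := by rw [Over.w ψ]
        _ = (s.snd ≫ a.left) ≫ A.X.hom := by rw [← Category.assoc, s.condition]
        _ = s.snd ≫ a.left ≫ A.X.hom := Category.assoc _ _ _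
        _ = s.snd ≫ 𝟙 _ := congrArg (s.snd ≫ ·) (point_left_comp_hom A a)
        _ = s.snd := Category.comp_id _
    have h : F ≫ ψ = toSpecOver S' ≫ a := by
      apply Over.OverMorphism.ext
      change s.fst ≫ ψ.left = (s.fst ≫ (C ⊗ W).hom) ≫ a.left
      rw [s.condition, hS]
    rw [comp_incidence_eq_const_iff A f w a ψ hψ sh hsh] at h
    exact (congrArg (fun g => g.left) h).symm
  · -- `lift ≫ t = s.fst`
    apply Over.tensorObj_ext
    · rw [Category.assoc, ← Over.fst_left, ht₁, hQ.lift_fst]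
    · rw [Category.assoc, ← Over.snd_left, ht₂, hQ.lift_snd]
  · -- `lift ≫ (q₁ ≫ C.hom) = s.snd`
    have hS : s.fst ≫ (C ⊗ W).hom = s.snd :=
      calc s.fst ≫ (C ⊗ W).hom = s.fst ≫ ψ.left ≫ A.X.hom := by rw [Over.w ψ]
        _ = (s.snd ≫ a.left) ≫ A.X.hom := by rw [← Category.assoc, s.condition]
        _ = s.snd ≫ a.left ≫ A.X.hom := Category.assoc _ _ _
        _ = s.snd ≫ 𝟙 _ := congrArg (s.snd ≫ ·) (point_left_comp_hom A a)
        _ = s.snd := Category.comp_id _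
    rw [← Category.assoc, hQ.lift_fst, Category.assoc, ← hS]
    rfl
  · -- uniqueness
    apply hQ.hom_ext
    · rw [hQ.lift_fst, ← hm₁, Category.assoc, ht₁]
    · rw [hQ.lift_snd, ← hm₁, Category.assoc, ht₂]

include hψ hsh in
/-- **The shear, with Mathlib՚s chosen fibre product**: `C ×_{ι_a, A, w} W` (`pullback ι_a.left w.left`) is the fibre of `ψ` over `a`,
via `t = pullback.lift fst snd` (recall `(C ⊗ W).left = C ×_k W = pullback C.hom W.hom`).
[cite: Milne1986JacobianVarieties, §6, proof of Lemma 6.7 (p. 187)] -/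
theorem isPullback_shear_pullback :
    IsPullback
      (pullback.lift (pullback.fst sh.left w.left) (pullback.snd sh.left w.left)
        (comp_hom_eq_of_isPullback A w sh (IsPullback.of_hasPullback sh.left w.left)) :
        pullback sh.left w.left ⟶ (C ⊗ W).left)
      (pullback.fst sh.left w.left ≫ C.hom) ψ.left a.left :=
  isPullback_shear A f w a ψ hψ sh hsh (IsPullback.of_hasPullback sh.left w.left) _ (pullback.lift_fst _ _ _)
    (pullback.lift_snd _ _ _)

end Shear

end AbelianVariety

end Literature.AlgebraicGeometry.Motives

end
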